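import Summits.Ventures.LatticeQCDFlow.Exactness.FreeFieldHMCMagnetisationCSD
import HarnessLib

/-!
# Resonant modes of the Metropolis-corrected free-field HMC are frozen: `Kᵏ F(O_b) = F(O_b)`, every autocovariance `C(k) = C(0)`

HONEST FRAMING: exact (Metropolis-corrected) sampling algorithms for lattice gauge theory;
figures of merit are autocorrelation/cost numbers at stated couplings and volumes; no
continuum-physics claim.  (SCALAR calibration rung S0-A: not a gauge result.)

Venture `LatticeQCDFlow` (cell pub-lqcd), topic `Exactness`; FANOUT row 2 (`s0-phi4`, HMC arm).
NEW WORK of the cell over row 2's `Scoring/FreeFieldLeapfrog` (exact mode decoupling of qpq leapfrog: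
every eigenmode `b` of `−Δ_lat` rotates autonomously with `Ω_κ² = 2(κ + m²)`),
`Scoring/FreeFieldHMCAutocorrelation` (the acceptance-one skeleton: a resonant mode is FIXED,
`unadjLeapfrogOp_id_of_resonance`) and `FreeFieldHMCMagnetisationCSD` (`hmcOpOf_eq_self_of_invariant`;
the zero mode).  Nothing is cited as a fact.  Printed counterparts, NAMED ONLY: Mackenzie 1989 (the
resonances of HMC at fixed trajectory length; randomised lengths as the cure), Kennedy–Pendleton 1991.

Setting: free field `S = Σ_x [Σ_μ (φ(σ_μ x) − φ_x)² + m² φ_x²]` (`J = shiftCoupling σ m²`, `λ = 0`),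
row 2's EXACT HMC update `K = hmcOpPhi4 J 0 δ N` (refresh, `N` qpq steps of size `δ`, flip, Metropolis
test, else keep); an eigenmode `b` of `−Δ_lat` with eigenvalue `κ`
(`Σ_μ (2b_x − b(σ_μ x) − b(σ_μ⁻¹ x)) = κ b_x`), `O_b = Σ_y b_y φ_y`, `Ω² = 2(κ + m²) > 0`, stable
regime `δ²Ω² < 4`, `θ = arccos(1 − δ²Ω²/2)`.

## What is proved

* **`free_mode_hmcProposal`** — THE MODE THROUGH THE PROPOSAL: `O_b((Ψ z).1) = cos(Nθ) O_b(z.1) +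
  β sin(Nθ) P_b(z.2)` (`P_b = Σ b_y p_y`, `β = δ(1 − δ²Ω²/4)/sin θ`), whatever the other modes do.
* **`free_mode_resonance_frozen`** — AT A RESONANCE OF THE MODE (`cos Nθ = 1`), for every function `F`
  and every `k`: `(Kᵏ F(O_b))(φ) = F(O_b(φ))`.  The proposal returns `O_b` exactly and rejection keeps
  it: the Metropolis-corrected chain started at `φ` never leaves the level set `{O_b = O_b(φ)}` — it
  is NOT ergodic, and this for every volume, every `m² > −κ`, every resonant pair `(δ, N)`.
* **`free_mode_resonance_autocov`** — consequently every autocovariance of `g = F(O_b)` (any weight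
  `ω`, any centring) equals the variance: `∫ g (Kᵏ g) ω = ∫ g² ω` for all `k` — `ρ_g(k) = 1`, the
  autocorrelation series does not decay at all (so every `τ_int` floor of the tree is vacuous-by-
  hypothesis there, correctly: `ρ_g(1) < 1` fails).

Reading for S0-A (no numerics implied): the accept/reject step does NOT cure the resonances of
fixed-length HMC on the free field — it inherits them exactly (the energy violation is blind to a
mode that has come back); only a spread of trajectory lengths does (`RandomisedHMC`,
`FreeFieldRandomisedHMCCSD`: the averaged denominator `E_w[1 − cos Nθ]` vanishes only if every supported
length is resonant).  NOT CLAIMED: anything at `λ > 0` (no exact resonances there); the measure of the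
set of resonant `δ` (countable, hence null — not typed).
-/

namespace Summit.Ventures.LatticeQCDFlow.Exactness

open Real MeasureTheory Filter Finset
open Summit.Ventures.LatticeQCDFlow.Scoring

section Free

variable {n : ℕ} {ι : Type*} [Fintype ι]

/-- **AN EIGENMODE THROUGH ONE HMC PROPOSAL, IN CLOSED FORM** (free field, `Ω² = 2(κ + m²) > 0`,
stable regime `δ²Ω² < 4`): `O_b((Ψ z).1) = cos(Nθ) O_b(z.1) + β sin(Nθ) P_b(z.2)`. -/
theorem free_mode_hmcProposal (σ : ι → Equiv.Perm (Fin (n + 1))) {m2 δ κ : ℝ} (hδ : 0 < δ)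
    {b : Fin (n + 1) → ℝ} (hb : ∀ x, ∑ μ, (2 * b x - b (σ μ x) - b ((σ μ).symm x)) = κ * b x)
    (hκ : 0 < κ + m2) (hst : δ ^ 2 * (2 * (κ + m2)) < 4) (N : ℕ)
    (z : (Fin (n + 1) → ℝ) × (Fin (n + 1) → ℝ)) :
    ∑ y, b y * (hmcProposal (shiftCoupling σ m2) 0 δ N z).1 y
      = Real.cos (N * Real.arccos (1 - δ ^ 2 * (2 * (κ + m2)) / 2)) * ∑ y, b y * z.1 y
        + δ * (1 - δ ^ 2 * (2 * (κ + m2)) / 4)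
            / Real.sin (Real.arccos (1 - δ ^ 2 * (2 * (κ + m2)) / 2))
          * Real.sin (N * Real.arccos (1 - δ ^ 2 * (2 * (κ + m2)) / 2)) * ∑ y, b y * z.2 y := by
  have h1 : (hmcProposal (shiftCoupling σ m2) 0 δ N z).1
      = ((leapfrogQPQ (shiftCoupling σ m2) 0 δ)^[N] z).1 := by
    simp [hmcProposal, momFlip]
  have h := congrArg Prod.fst (leapfrog_iterate_mode σ m2 δ hb N z)
  simp only [] at h
  rw [h1, h, lfMode_iterate_fst hδ (by positivity) hst]

/-- **AT A RESONANCE THE EXACT CHAIN FREEZES THE MODE**: if `cos(Nθ) = 1` then for every function `F`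
of the mode observable, every `k` and every `φ`: `(Kᵏ F(O_b))(φ) = F(O_b(φ))`. -/
theorem free_mode_resonance_frozen (σ : ι → Equiv.Perm (Fin (n + 1))) {m2 δ κ : ℝ} (hδ : 0 < δ)
    {b : Fin (n + 1) → ℝ} (hb : ∀ x, ∑ μ, (2 * b x - b (σ μ x) - b ((σ μ).symm x)) = κ * b x)
    (hκ : 0 < κ + m2) (hst : δ ^ 2 * (2 * (κ + m2)) < 4) {N : ℕ}
    (hc : Real.cos (N * Real.arccos (1 - δ ^ 2 * (2 * (κ + m2)) / 2)) = 1) (F : ℝ → ℝ) (k : ℕ)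
    (φ : Fin (n + 1) → ℝ) :
    ((hmcOpPhi4 (shiftCoupling σ m2) 0 δ N)^[k] (fun ψ => F (∑ y, b y * ψ y))) φ
      = F (∑ y, b y * φ y) := by
  have hsin : Real.sin (N * Real.arccos (1 - δ ^ 2 * (2 * (κ + m2)) / 2)) = 0 := by
    have h := Real.sin_sq_add_cos_sq (N * Real.arccos (1 - δ ^ 2 * (2 * (κ + m2)) / 2))
    rw [hc, one_pow] at h
    exact pow_eq_zero_iff (two_ne_zero) |>.mp (by linarith)
  have hinv : ∀ z : (Fin (n + 1) → ℝ) × (Fin (n + 1) → ℝ),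
      ∑ y, b y * (hmcProposal (shiftCoupling σ m2) 0 δ N z).1 y = ∑ y, b y * z.1 y := by
    intro z
    rw [free_mode_hmcProposal σ hδ hb hκ hst N z, hc, hsin]
    ring
  have hfix : ∀ ψ : Fin (n + 1) → ℝ,
      hmcOpPhi4 (shiftCoupling σ m2) 0 δ N (fun ψ => F (∑ y, b y * ψ y)) ψ = F (∑ y, b y * ψ y) := by
    intro ψ
    unfold hmcOpPhi4
    exact hmcOpOf_eq_self_of_invariant _ _ _ (fun p => by rw [hinv (ψ, p)])
  have hfun : hmcOpPhi4 (shiftCoupling σ m2) 0 δ N (fun ψ => F (∑ y, b y * ψ y))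
      = fun ψ => F (∑ y, b y * ψ y) := funext hfix
  induction k with
  | zero => rfl
  | succ k ih =>
      rw [Function.iterate_succ_apply, hfun]
      exact ih

/-- **Hence every autocovariance of a resonant mode equals its variance**: for `g = F(O_b)` and any
weight `ω` (e.g. `e^{−S}`), `∫ g · (Kᵏ g) · ω = ∫ g² ω` for every `k` — `ρ_g ≡ 1`. -/
theorem free_mode_resonance_autocov (σ : ι → Equiv.Perm (Fin (n + 1))) {m2 δ κ : ℝ} (hδ : 0 < δ)
    {b : Fin (n + 1) → ℝ} (hb : ∀ x, ∑ μ, (2 * b x - b (σ μ x) - b ((σ μ).symm x)) = κ * b x)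
    (hκ : 0 < κ + m2) (hst : δ ^ 2 * (2 * (κ + m2)) < 4) {N : ℕ}
    (hc : Real.cos (N * Real.arccos (1 - δ ^ 2 * (2 * (κ + m2)) / 2)) = 1) (F : ℝ → ℝ)
    (ω : (Fin (n + 1) → ℝ) → ℝ) (k : ℕ) :
    ∫ φ, F (∑ y, b y * φ y)
        * ((hmcOpPhi4 (shiftCoupling σ m2) 0 δ N)^[k] (fun ψ => F (∑ y, b y * ψ y))) φ * ω φ
      = ∫ φ, F (∑ y, b y * φ y) ^ 2 * ω φ := by
  refine integral_congr_ae (Eventually.of_forall fun φ => ?_)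
  dsimp only
  rw [free_mode_resonance_frozen σ hδ hb hκ hst hc F k φ]
  ring

/-- **The zero mode** (`b = 𝟙`, `κ = 0`: the magnetisation) is the case of
`FreeFieldHMCMagnetisationCSD.free_resonance_frozen`; here is the general-mode statement specialised
back to it, as a consistency check: at `cos(Nθ₀) = 1`, `Kᵏ F(M) = F(M)`. -/
theorem free_magnetisation_resonance_frozen' (σ : ι → Equiv.Perm (Fin (n + 1))) {m2 δ : ℝ}
    (hδ : 0 < δ) (hm : 0 < m2) (hst : δ ^ 2 * (2 * m2) < 4) {N : ℕ}
    (hc : Real.cos (N * Real.arccos (1 - δ ^ 2 * (2 * m2) / 2)) = 1) (F : ℝ → ℝ) (k : ℕ)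
    (φ : Fin (n + 1) → ℝ) :
    ((hmcOpPhi4 (shiftCoupling σ m2) 0 δ N)^[k] (fun ψ => F (∑ y, ψ y))) φ = F (∑ y, φ y) := by
  have hb := zeroMode_eigen (n := n) σ
  have hκ : (0 : ℝ) < 0 + m2 := by linarith
  have hst' : δ ^ 2 * (2 * (0 + m2)) < 4 := by rw [zero_add]; exact hst
  have hc' : Real.cos (N * Real.arccos (1 - δ ^ 2 * (2 * (0 + m2)) / 2)) = 1 := by
    rw [zero_add]; exact hc
  have h := free_mode_resonance_frozen σ hδ hb hκ hst' hc' F k φ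
  simp only [one_mul] at h
  exact h

end Free

end Summit.Ventures.LatticeQCDFlow.Exactness
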